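import Summits.Parity.GeneralizedHardyLittlewood.Theses.LiouvilleShiftedTables

/-!
# Route LiouvilleShiftedTables — the Assembly item (stmt-Parity-14669)

`Assembly` is the type of the route's crux-only deciding theorem `closes`:
`DilatedTableChowla → TypeI2Dilated → ElliottHalberstam → EngineToPairs → PairsToGHL →
GeneralizedHardyLittlewood`.  It is pure logic: the one-piece glue crux `EngineToPairs`
turns the parity engine `DilatedTableChowla ∧ TypeI2Dilated` and the bridge premise
`ElliottHalberstam` into Hardy–Littlewood pairs at every fixed shift, and `PairsToGHL`
carries pairs to the sub-problem statement.
-/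

namespace Summit.Parity.GeneralizedHardyLittlewood.Theorems

open Summit.Parity.GeneralizedHardyLittlewood.Theses.LiouvilleShiftedTables

/-- The Assembly item of route LiouvilleShiftedTables (stmt-Parity-14669): the implication chain
`DilatedTableChowla → TypeI2Dilated → ElliottHalberstam → EngineToPairs → PairsToGHL →
GeneralizedHardyLittlewood` holds by composing the hypotheses — the glue crux `EngineToPairs`
applied to the two engine cruxes and the bridge premise gives fixed-shift Hardy–Littlewood pairs,
and `PairsToGHL` maps pairs to `GeneralizedHardyLittlewood` (the same term as the deciding
theorem `closes`). -/
theorem liouvilleShiftedTablesAssembly_proof :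
    Summit.Parity.GeneralizedHardyLittlewood.Theses.LiouvilleShiftedTables.Assembly := by
  unfold Summit.Parity.GeneralizedHardyLittlewood.Theses.LiouvilleShiftedTables.Assembly
  intro hD hI hE hX hG
  exact hG (hX hD hI hE)

end Summit.Parity.GeneralizedHardyLittlewood.Theorems
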